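/-
Copyright (c) 2026 the pub-hodgecm-mathlib formalisation cell (harness21).  Prover seat hodgecm-mathlib-LH4-p13 (g6), req620 Track A «(D-RAM) FOUR-FRAME» squad, unit U2H:
the (ρ2b′-X) child `stub_U2H_fixedPointCensus_typeTwo_unit0` (U2H :418) — organ **S9-R «O-Sign, TYPE RamK»** of the payer LH4-p14 (g4)'s HEAD-OF-ORGANS MAP v2 (dealer LH4-plan
(g12) WORD #28 «S9-R + tok → p13»): the EXACT algebra of the RamK sign and the (D3) hyperbolic-side unit.  2026-09-04.
-/
import Literature.NumberTheory.LocalFields.QuadraticOrderThetaFixedUnits     -- ★ p857302 (F0P3-p01 (g32)) (M-RK1): `exists_fixed_fixed_mul_of_eq_fixed_mul`, `v_sub_one_le_of_theta_fixed`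
import Literature.NumberTheory.LocalFields.WildQuadraticDatumTrace            -- ★ `v_varpi_pow`, `even_log_v_of_fixed`
import HarnessLib

/-!
# Crux `H413`, line LH4 «(D-RAM) FOUR-FRAME» — unit U2H, (ρ2b′-X): organ S9-R — THE TYPE-RamK SIGN IS THE `K♮`-NORM CLASS OF ONE `Θ`-FIXED ELEMENT `κ`
# `κ := (λ′ − u′)(1 + λ′)(1 + u′) ∕ (ω·λ′·u′)`,  `x·N(1+λ′)·N(1+u′) = −ω²·κ·ρκ`,  and the (D3) unit of the hyperbolic side is `κ₀·e·w`

Cell `hodgecm-mathlib` (D-0151), FLOOR 0, crux item H413 = `stmt-HodgeConjecture-24833`, route of record `HCCMUnconditional`; squad F0∕P3c∕LH4; registered stub served: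
`F0P3cDyRamFourFrameU2H.stub_U2H_fixedPointCensus_typeTwo_unit0` ((ρ2b′-X), U2H :418) through LH4-p14's ★ spine ∕ HEAD-OF-ORGANS (sockets (A) `hLitA`, (C) `hCensus`; the (C0)
census file, RK branch: ★ p857635 `toricCensusSum_ramK` with its side letter `ε`, the socket's sign `(β, θ)_v`).  THEOREMS ONLY (no `def`, no instance, no notation, no `sorry`); lane
`--supports stmt-HodgeConjecture-24833` (count-neutral).  Companion of ★ p857764 `F0P3cDyRamTokenRealizabilityRamK` (S6b-RK) and of ★ p857454∕p857550 (O-Sign type U ∕ class-free).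

THE LETTERS (one field `K` = the biquadratic `M`; `ρ` fixes `E`, `Θ` fixes the third field `K♮`, `ρΘ = Θρ`; type RamK = `K♮∕F` unramified).  `λ′ := λ∕δ` and `u′ := u∕δ` (★ p857454:
`δ ∈ E¹`, `δ² = D = det γ₂`) satisfy **`λ′·Θλ′ = 1 = λ′·ρλ′`** (so `Θλ′ = ρλ′ = λ′⁻¹`: `λ′` lies in the norm-one torus of the DESCENT field `Fix(Θρ)`) and `ρu′ = u′`, `u′·Θu′ = 1`
(`u′ ∈ E¹`); `ω ∈ E` with `Θω = −ω` is the anti-fixed square root of `θ` (★ `exists_antifixed_sq_eq_toPlace_cmQuadraticGenerator`: `ω² = ι θ`); `μ′ := λ′ − u′` (`μ = λ − u = δ·μ′`);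
`x := Tr λ′ − Tr u′ = (λ′ + ρλ′) − (u′ + Θu′)` is ★ p857454's depth letter (`ι x = −χ∕(uδ)`, `β = x·y` with `(y, θ)_v = 1` deep, so `(β, θ)_v = (x, θ)_v`).
THE MATHEMATICS.  (§1) With the Hilbert-90 numerators `1 + λ′` (for `λ′ = (1+λ′)∕ρ(1+λ′)`) and `1 + u′` (for `u′ = (1+u′)∕σ(1+u′)`), the element
`W := (1+λ′)·σ(1+u′) − ρ(1+λ′)·(1+u′) = μ′(1+λ′)(1+u′)∕(λ′u′)` is `Θ`-ANTI-fixed, so **`κ := W∕ω = μ′(1+λ′)(1+u′)∕(ω λ′ u′)` is `Θ`-FIXED** (`theta_map_signKappa`), with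
`ρκ = (1 − λ′u′)(1+λ′)(1+u′)∕(ω λ′ u′)`.  (§2) `N_{M∕E}(μ′) = μ′·ρμ′ = −u′·x`, `μ′·Θρμ′ = λ′·x`, and **`x·N_{K∕F}(1+λ′)·N_{E∕F}(1+u′) = −ω²·κ·ρκ = −θ·N_{K♮∕F}(κ)`**
(`traceDiff_mul_norms_eq_neg_sq_mul_norm_signKappa`): hence `(β,θ)_v = (x,θ)_v = (N_{K♮∕F} κ, θ)_v · (N_{K∕F}(1+λ′), θ)_v` (`(−θ, θ) = 1`, `(N_{E∕F}(1+u′), θ) = 1`), and the last factor is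
`+1` once `|λ′ − 1| ≤ |ϖ|^{d+t}` (`N_{K∕F}(1+λ′) = 4·(1 − N_{K∕F}(λ′−1)∕4)` is a deep unit of `F`) — THE RamK SIGN IS `(κ, θ)_{K♮} = [κ ∈ N_{M∕K♮}(Mˣ)]`.  (§3) The factorisation
**`μ′ = κ · (ωu′∕(1+u′)) · (λ′∕(1+λ′))`**: the middle factor lies in `E`, and `2λ′∕(1+λ′) − 1 = (λ′ − 1)∕(1 + λ′)` has valuation `|λ′ − 1|∕|2| = exp(−(m_λ − t))` when `|λ′ − 1| < |2|`.
(§4) Hence the (D3) unit of the HYPERBOLIC side, `z₊ = μ′·E₁` (`E₁ ∈ E`: `δ·h·(α₀ − ρα₀)∕ϖE^n`), DECOMPOSES EXPLICITLY as `z₊ = k·e·w` with `k = κ·(ϖEΘϖE)^j` a `Θ`-fixed UNIT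
(`κ` has even valuation: `Θ`-fixed), `e ∈ 𝒪_Eˣ`, `w = 2λ′∕(1+λ′)`, `|w − 1| = exp(−(m_λ − t))`: the T5b (D3) «some side alive» datum at every depth `c ≤ m_λ − t`, with the norm
identity carried along (`exists_diagUnit_decomp`).  (§5) For any such decomposition at a FAR depth (`2d ≤ c + 1`): **the hyperbolic cell is alive ⟺ `k` is a hermitian norm `xΘx`**
(`diag_alive_iff_exists_mul_theta_eq`; `→` by ★ (M-RK1) `𝒪_{K♮}ˣ ∩ 𝒪_EˣU^{(c)} = 𝒪_FˣU_{K♮}^{(⌈c∕2⌉)}` and the two RamK norm suppliers `hNF`, `hNd` of ★ p857764).  Chain for the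
payer at a far cell with `2d − 1 ≤ c ≤ m_λ − t`: alive₊ ⟺ `k ∈ N` ⟺ `(N_{K♮∕F}k, θ)_v = 1` ⟺ (§2, `k·ρk = κρκ·(ϖEΘϖE)^{2j}`) `(x, θ)_v = 1` ⟺ `(β, θ)_v = 1`; the same side at
every far `c′ ≤ D` then follows from side-constancy under the (S6-RK) depth-`D` decomposition (★ (M-RK1) again).  V-LETTERS used: `|λ′ − 1| < |2|`, `|u′ − 1| < |2|` (γ_H near 1).
Evidence: F0P3-p01 (g32) T5b memo §7 (alive side = `ε(β)` on every deep diagonal cell of the RamK cells (2,2), (2,3); tame 453∕453); LH4-p12 (g3) PAYER-PLAN v2 §6.3 (ii)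
«decided by ONE Hilbert symbol `(z, θ_E)_{K♮}`».
HONEST LABEL.  Count-neutral helper; (ρ2b′-X) OPEN; `HC_CM` is proved only modulo the 7 printed citations (2 remaining named inputs: hLiu418 = `stmt-HodgeConjecture-24832`, h413 =
`stmt-HodgeConjecture-24833`) until rung 0 closes.

## References
* [Rogawski1990] J. D. Rogawski, *Automorphic Representations of Unitary Groups in Three Variables*, Ann. of Math. Stud. 123 (1990), §4.9 Prop. 4.9.1 (b) p. 55, Lemma 4.9.3 p. 56.
* [LabesseLanglands1979] J.-P. Labesse, R. P. Langlands, *L-indistinguishability for SL(2)*, Canad. J. Math. 31 (1979), §2 (2.1)–(2.2).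
* [Serre1979] J.-P. Serre, *Local Fields*, GTM 67 (1979), Ch. V §2 Prop. 3, §3 Cor. 3; Ch. X §1 (Hilbert 90); Ch. III §6 Prop. 12.
* [Flicker1998UnitaryFL] Y. Z. Flicker, *Elementary proof of the fundamental lemma for a unitary group*, Canad. J. Math. 50 (1998), Prop. 7 p. 84.
-/

set_option autoImplicit false

open WithZero

namespace Summit.HodgeConjecture.HodgeConjecture.Cruxes.H413.F0P3cDyRamTokenSignRamK

open Literature.NumberTheory.LocalFields.QuadraticOrder (exists_fixed_fixed_mul_of_eq_fixed_mul v_sub_one_le_of_theta_fixed)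
open Literature.NumberTheory.LocalFields.WildQuadraticDatum (v_varpi_pow even_log_v_of_fixed)

variable {K : Type*} [Field K]

/-! ## §1 The `Θ`-fixed element `κ` -/

/-- **`κ := (λ′ − u′)(1+λ′)(1+u′)∕(ω λ′ u′)` IS `Θ`-FIXED.**  For `λ′` with `λ′Θλ′ = 1 = λ′ρλ′`, `u′` with `ρu′ = u′`, `u′Θu′ = 1`, and `ω` with `Θω = −ω`:
`Θκ = κ` — `κ = W∕ω` with `W = (1+λ′)σ(1+u′) − ρ(1+λ′)(1+u′)·(λ′u′)⁻¹…` `Θ`-anti-fixed (Hilbert 90 numerators of `λ′`, `u′`). [cite: Serre1979, Ch. X §1] [cite: Rogawski1990, §4.9 Lemma 4.9.3 p. 56] -/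
theorem theta_map_signKappa {Θ : K →+* K} {lam u ω : K} (hlamΘ : lam * Θ lam = 1) (hu1 : u * Θ u = 1) (hΘω : Θ ω = -ω) :
    Θ ((lam - u) * (1 + lam) * (1 + u) / (ω * lam * u)) = (lam - u) * (1 + lam) * (1 + u) / (ω * lam * u) := by
  have hlam0 : lam ≠ 0 := fun h => by rw [h, zero_mul] at hlamΘ; exact zero_ne_one hlamΘ
  have hu0 : u ≠ 0 := fun h => by rw [h, zero_mul] at hu1; exact zero_ne_one hu1
  have hΘlam : Θ lam = lam⁻¹ := eq_inv_of_mul_eq_one_right hlamΘ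
  have hΘu : Θ u = u⁻¹ := eq_inv_of_mul_eq_one_right hu1
  rcases eq_or_ne ω 0 with hω | hω0
  · rw [hω, zero_mul, zero_mul, div_zero, map_zero]
  rw [map_div₀, map_mul, map_mul, map_mul, map_mul, map_sub, map_add, map_add, map_one, hΘlam, hΘu, hΘω]
  field_simp
  ring

/-- **`ρκ`**: with moreover `ρu′ = u′`, `ρω = ω`: `ρκ = (1 − λ′u′)(1+λ′)(1+u′)∕(ω λ′ u′)`. [cite: Serre1979, Ch. X §1] -/
theorem rho_map_signKappa {ρ Θ : K →+* K} {lam u ω : K} (hlamρ : lam * ρ lam = 1) (hu : ρ u = u) (hu1 : u * Θ u = 1) (hρω : ρ ω = ω) :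
    ρ ((lam - u) * (1 + lam) * (1 + u) / (ω * lam * u)) = (1 - lam * u) * (1 + lam) * (1 + u) / (ω * lam * u) := by
  have hlam0 : lam ≠ 0 := fun h => by rw [h, zero_mul] at hlamρ; exact zero_ne_one hlamρ
  have hu0 : u ≠ 0 := fun h => by rw [h, zero_mul] at hu1; exact zero_ne_one hu1
  have hρlam : ρ lam = lam⁻¹ := eq_inv_of_mul_eq_one_right hlamρ
  rcases eq_or_ne ω 0 with hω | hω0
  · rw [hω, zero_mul, zero_mul, div_zero, div_zero, map_zero]
  rw [map_div₀, map_mul, map_mul, map_mul, map_mul, map_sub, map_add, map_add, map_one, hρlam, hu, hρω]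
  field_simp
  ring

/-! ## §2 The norm identities: `N_{M∕E}(μ′) = −u′x`, `μ′·Θρμ′ = λ′x`, `x·N(1+λ′)·N(1+u′) = −ω²·κρκ` -/

/-- **`N_{M∕E}(μ′) = −u′·x`**: `(λ′ − u′)·ρ(λ′ − u′) = −u′·((λ′ + ρλ′) − (u′ + Θu′))` (`λ′ρλ′ = 1`, `u′Θu′ = 1`, `ρu′ = u′`). [cite: Rogawski1990, §4.9 p. 55] [cite: LabesseLanglands1979, §2 (2.1)–(2.2)] -/
theorem sub_mul_rho_sub_eq {ρ Θ : K →+* K} {lam u : K} (hlamρ : lam * ρ lam = 1) (hu : ρ u = u) (hu1 : u * Θ u = 1) :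
    (lam - u) * ρ (lam - u) = -(u * ((lam + ρ lam) - (u + Θ u))) := by
  have hlam0 : lam ≠ 0 := fun h => by rw [h, zero_mul] at hlamρ; exact zero_ne_one hlamρ
  have hu0 : u ≠ 0 := fun h => by rw [h, zero_mul] at hu1; exact zero_ne_one hu1
  have hρlam : ρ lam = lam⁻¹ := eq_inv_of_mul_eq_one_right hlamρ
  have hΘu : Θ u = u⁻¹ := eq_inv_of_mul_eq_one_right hu1
  rw [map_sub, hu, hΘu, hρlam]
  field_simp
  ring

/-- **`μ′·Θρ(μ′) = λ′·x`**: `(λ′ − u′)·Θ(ρ(λ′ − u′)) = λ′·((λ′ + ρλ′) − (u′ + Θu′))` (`Θρλ′ = λ′` since `Θλ′ = ρλ′ = λ′⁻¹` and `ρ` is an involution on `λ′`'s orbit).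
[cite: Rogawski1990, §4.9 p. 55] [cite: LabesseLanglands1979, §2 (2.1)–(2.2)] -/
theorem sub_mul_theta_rho_sub_eq {ρ Θ : K →+* K} {lam u : K} (hlamΘ : lam * Θ lam = 1) (hlamρ : lam * ρ lam = 1) (hu : ρ u = u) (hu1 : u * Θ u = 1) :
    (lam - u) * Θ (ρ (lam - u)) = lam * ((lam + ρ lam) - (u + Θ u)) := by
  have hlam0 : lam ≠ 0 := fun h => by rw [h, zero_mul] at hlamρ; exact zero_ne_one hlamρ
  have hu0 : u ≠ 0 := fun h => by rw [h, zero_mul] at hu1; exact zero_ne_one hu1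
  have hρlam : ρ lam = lam⁻¹ := eq_inv_of_mul_eq_one_right hlamρ
  have hΘlam : Θ lam = lam⁻¹ := eq_inv_of_mul_eq_one_right hlamΘ
  have hΘu : Θ u = u⁻¹ := eq_inv_of_mul_eq_one_right hu1
  have hΘρlam : Θ (ρ lam) = lam := by rw [hρlam, map_inv₀, hΘlam, inv_inv]
  rw [map_sub ρ, map_sub Θ, hΘρlam, hu, hΘu, hρlam]
  field_simp
  ring

/-- **THE SIGN IDENTITY: `x·N_{K∕F}(1+λ′)·N_{E∕F}(1+u′) = −ω²·κ·ρκ`** — with `x = (λ′ + ρλ′) − (u′ + Θu′)`, `N_{K∕F}(1+λ′) = (1+λ′)(1+ρλ′)`, `N_{E∕F}(1+u′) = (1+u′)(1+Θu′)` and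
`κρκ = N_{K♮∕F}(κ)`: all five are `ρ`- and `Θ`-fixed, so in Hilbert-symbol currency `(x, θ)_v = (N_{K♮∕F}κ, θ)_v·(N_{K∕F}(1+λ′), θ)_v` (`ω² = θ`, `(−θ,θ) = 1`, norms from `E` are
trivial). [cite: Rogawski1990, §4.9 Lemma 4.9.3 p. 56] [cite: LabesseLanglands1979, §2 (2.1)–(2.2)] [cite: Serre1979, Ch. X §1] -/
theorem traceDiff_mul_norms_eq_neg_sq_mul_norm_signKappa {ρ Θ : K →+* K} {lam u ω : K} (hlamρ : lam * ρ lam = 1)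
    (hu : ρ u = u) (hu1 : u * Θ u = 1) (hρω : ρ ω = ω) (hω0 : ω ≠ 0) :
    ((lam + ρ lam) - (u + Θ u)) * ((1 + lam) * (1 + ρ lam)) * ((1 + u) * (1 + Θ u)) =
      -(ω ^ 2 * ((lam - u) * (1 + lam) * (1 + u) / (ω * lam * u) * ρ ((lam - u) * (1 + lam) * (1 + u) / (ω * lam * u)))) := by
  have hlam0 : lam ≠ 0 := fun h => by rw [h, zero_mul] at hlamρ; exact zero_ne_one hlamρ
  have hu0 : u ≠ 0 := fun h => by rw [h, zero_mul] at hu1; exact zero_ne_one hu1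
  have hρlam : ρ lam = lam⁻¹ := eq_inv_of_mul_eq_one_right hlamρ
  have hΘu : Θ u = u⁻¹ := eq_inv_of_mul_eq_one_right hu1
  rw [rho_map_signKappa hlamρ hu hu1 hρω, hρlam, hΘu]
  field_simp
  ring

/-! ## §3 The factorisation `μ′ = κ·(ωu′∕(1+u′))·(λ′∕(1+λ′))` and the depth of `2λ′∕(1+λ′)` -/

/-- **`μ′ = κ · (ωu′∕(1+u′)) · (λ′∕(1+λ′))`** (definition of `κ`, unfolded; `1+λ′, 1+u′, ω, λ′, u′ ≠ 0`): the middle factor is `ρ`-fixed (in `E`), the last lies in the descent field.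
[cite: Serre1979, Ch. X §1] -/
theorem sub_eq_signKappa_mul {lam u ω : K} (hlam0 : lam ≠ 0) (hu0 : u ≠ 0) (hω0 : ω ≠ 0) (h1lam : 1 + lam ≠ 0) (h1u : 1 + u ≠ 0) :
    lam - u = (lam - u) * (1 + lam) * (1 + u) / (ω * lam * u) * (ω * u / (1 + u)) * (lam / (1 + lam)) := by
  field_simp

/-- **`2λ′∕(1+λ′) − 1 = (λ′ − 1)∕(1 + λ′)`** (`1 + λ′ ≠ 0`). [cite: Serre1979, Ch. X §1] -/
theorem two_mul_div_one_add_sub_one {lam : K} (h1lam : 1 + lam ≠ 0) : 2 * lam / (1 + lam) - 1 = (lam - 1) / (1 + lam) := by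
  field_simp
  ring

variable [Valued K ℤᵐ⁰]

/-- **DEPTH OF `w := 2λ′∕(1+λ′)`**: if `|λ′ − 1| = exp(−m_λ) < |2| = exp(−t)` then `|1 + λ′| = |2|` and `|w − 1| = exp(−(m_λ − t))`. [cite: Serre1979, Ch. V §1] -/
theorem v_two_mul_div_one_add_sub_one {lam : K} {mlam t : ℕ} (h2t : Valued.v (2 : K) = exp (-(t : ℤ))) (hlam1 : Valued.v (lam - 1) = exp (-(mlam : ℤ)))
    (htm : t < mlam) : Valued.v (1 + lam) = exp (-(t : ℤ)) ∧ Valued.v (2 * lam / (1 + lam) - 1) = exp (-((mlam : ℤ) - t)) := by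
  have hlt : Valued.v (lam - 1) < Valued.v (2 : K) := by rw [h2t, hlam1, exp_lt_exp]; omega
  have h1 : Valued.v (1 + lam) = exp (-(t : ℤ)) := by
    rw [show 1 + lam = 2 + (lam - 1) by ring, Valuation.map_add_eq_of_lt_left _ hlt, h2t]
  have h1lam : 1 + lam ≠ 0 := fun h => by rw [h, map_zero] at h1; exact (exp_ne_zero h1.symm).elim
  refine ⟨h1, ?_⟩
  rw [two_mul_div_one_add_sub_one h1lam, map_div₀, hlam1, h1, ← exp_sub]
  congr 1; ring

/-! ## §4 THE EXPLICIT (D3) DECOMPOSITION OF THE HYPERBOLIC-SIDE UNIT at depth `≤ m_λ − t` -/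

/-- **THE HYPERBOLIC (D3) UNIT IS `κ₀·e·w`, EXPLICITLY.**  Frame: `ρ, Θ` commuting (`ρ` on `ϖE`, `ω`, `u′`; `Θ` on `λ′`, `u′`, `ω`, `ϖE`), `ϖE` a `ρ`-fixed uniformiser, `Θ`-fixed
non-zero elements of even valuation (`hΘev`, the RamK datum clause), `|2| = exp(−t)`.  Data: `λ′` (`λ′Θλ′ = 1 = λ′ρλ′`, `|λ′ − 1| = exp(−m_λ)`, `t < m_λ`), `u′` (`ρu′ = u′`,
`u′Θu′ = 1`, `|u′ − 1| < |2|`), `ω` (`ρω = ω`, `Θω = −ω`, `ω ≠ 0`), `λ′ ≠ u′`, a `ρ`-fixed `E₁` and the UNIT `z := (λ′ − u′)·E₁` (the (D3) `z₊ = μ·h·(α₀ − ρα₀)∕ϖE^n` of ★ T5b,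
`μ = δμ′`).  Then for every `c ≤ m_λ − t`: `z = k·e·w` with `k` a `Θ`-fixed UNIT, `e` a `ρ`-fixed unit, `|w − 1| ≤ exp(−c)`, and `k = κ·(ϖE·ΘϖE)^j` for some `j : ℤ` — so
`k·ρk = κρκ·(ϖEΘϖE)^{2j}` inherits §2's sign identity (`ϖEΘϖE ∈ F`).  This is the «some side alive» datum of ★ p857764 `hyperbolic_alive_of_alive_of_two_mul_le` and the input of §5.
[cite: Serre1979, Ch. X §1; Ch. V §1] [cite: Flicker1998UnitaryFL, p. 84] [cite: Rogawski1990, §4.9 Lemma 4.9.3 p. 56] -/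
theorem exists_diagUnit_decomp {ρ Θ : K →+* K} (hΘΘ : ∀ x, Θ (Θ x) = x) (hρΘ : ∀ x, ρ (Θ x) = Θ (ρ x))
    (hΘv : ∀ x, Valued.v (Θ x) = Valued.v x)
    {ϖE : K} (hϖE : Valued.v ϖE = exp (-1 : ℤ)) (hρϖ : ρ ϖE = ϖE)
    (hΘev : ∀ x : K, Θ x = x → x ≠ 0 → ∃ n : ℤ, Valued.v x = exp (2 * n))
    {t : ℕ} (h2t : Valued.v (2 : K) = exp (-(t : ℤ)))
    {lam u ω E₁ : K} (hlamΘ : lam * Θ lam = 1) (hlamρ : lam * ρ lam = 1) {mlam : ℕ} (hlam1 : Valued.v (lam - 1) = exp (-(mlam : ℤ))) (htm : t < mlam)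
    (hu : ρ u = u) (hu1 : u * Θ u = 1) (hu2 : Valued.v (u - 1) < Valued.v (2 : K))
    (hρω : ρ ω = ω) (hΘω : Θ ω = -ω) (hω0 : ω ≠ 0) (hne : lam ≠ u) (hρE : ρ E₁ = E₁) (hz : Valued.v ((lam - u) * E₁) = 1)
    {c : ℕ} (hc : c + t ≤ mlam) :
    ∃ (k e w : K) (j : ℤ), Θ k = k ∧ Valued.v k = 1 ∧ ρ e = e ∧ Valued.v e = 1 ∧ Valued.v (w - 1) ≤ exp (-(c : ℤ)) ∧ (lam - u) * E₁ = k * e * w ∧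
      k = (lam - u) * (1 + lam) * (1 + u) / (ω * lam * u) * (ϖE * Θ ϖE) ^ j := by
  have hlam0 : lam ≠ 0 := fun h => by rw [h, zero_mul] at hlamρ; exact zero_ne_one hlamρ
  have hu0 : u ≠ 0 := fun h => by rw [h, zero_mul] at hu1; exact zero_ne_one hu1
  have h20 : (2 : K) ≠ 0 := fun h => by rw [h, map_zero] at h2t; exact (exp_ne_zero h2t.symm).elim
  obtain ⟨h1lamv, hwv⟩ := v_two_mul_div_one_add_sub_one h2t hlam1 htm
  have h1lam : 1 + lam ≠ 0 := fun h => by rw [h, map_zero] at h1lamv; exact (exp_ne_zero h1lamv.symm).elim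
  have h1uv : Valued.v (1 + u) = Valued.v (2 : K) := by
    rw [show 1 + u = 2 + (u - 1) by ring, Valuation.map_add_eq_of_lt_left _ hu2]
  have h1u : 1 + u ≠ 0 := fun h => by rw [h, map_zero] at h1uv; exact h20 ((Valuation.zero_iff _).1 h1uv.symm)
  -- `κ` and its valuation parity
  set κ := (lam - u) * (1 + lam) * (1 + u) / (ω * lam * u) with hκ
  have hΘκ : Θ κ = κ := theta_map_signKappa hlamΘ hu1 hΘω
  have hκ0 : κ ≠ 0 := by
    rw [hκ]
    exact div_ne_zero (mul_ne_zero (mul_ne_zero (sub_ne_zero.2 hne) h1lam) h1u) (mul_ne_zero (mul_ne_zero hω0 hlam0) hu0)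
  obtain ⟨n, hn⟩ := hΘev κ hΘκ hκ0
  -- the `F`-element `π₂ := ϖE·ΘϖE` of valuation `exp(−2)`
  set π₂ := ϖE * Θ ϖE with hπ₂
  have hρπ₂ : ρ π₂ = π₂ := by rw [hπ₂, map_mul, hρϖ, hρΘ, hρϖ]
  have hΘπ₂ : Θ π₂ = π₂ := by rw [hπ₂, map_mul, hΘΘ, mul_comm]
  have hvπ₂ : Valued.v π₂ = exp (-2 : ℤ) := by
    rw [hπ₂, Valuation.map_mul, hΘv, hϖE, ← exp_add]; rfl
  have hπ₂0 : π₂ ≠ 0 := fun h => by rw [h, map_zero] at hvπ₂; exact (exp_ne_zero hvπ₂.symm).elim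
  -- the pieces
  set k := κ * π₂ ^ n with hk
  set w := 2 * lam / (1 + lam) with hw
  set e := E₁ * (ω * u / (2 * (1 + u))) * (π₂ ^ n)⁻¹ with he
  have hΘk : Θ k = k := by rw [hk, map_mul, map_zpow₀, hΘκ, hΘπ₂]
  have hvk : Valued.v k = 1 := by
    rw [hk, Valuation.map_mul, map_zpow₀, hn, hvπ₂, ← exp_zsmul, ← exp_add, ← exp_zero]
    congr 1; simp only [smul_eq_mul]; ring
  have hρe : ρ e = e := by
    rw [he, map_mul, map_mul, map_inv₀, map_zpow₀, hρE, hρπ₂, map_div₀, map_mul, map_mul, hρω, hu, map_add, map_one, hu, map_ofNat]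
  have hzkew : (lam - u) * E₁ = k * e * w := by
    rw [hk, he, hw, hκ]
    field_simp
  have hwc : Valued.v (w - 1) ≤ exp (-(c : ℤ)) := by
    rw [hw, hwv, exp_le_exp]; omega
  have hvw : Valued.v w = 1 := by
    have hlt : Valued.v (w - 1) < Valued.v (1 : K) := by
      rw [Valuation.map_one, hwv, ← exp_zero, exp_lt_exp]; omega
    have h := Valuation.map_add_eq_of_lt_left _ hlt
    rwa [add_sub_cancel, Valuation.map_one] at h
  have hve : Valued.v e = 1 := by
    have h := hz
    rw [hzkew, Valuation.map_mul, Valuation.map_mul, hvk, hvw, one_mul, mul_one] at h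
    exact h
  exact ⟨k, e, w, n, hΘk, hvk, hρe, hve, hwc, hzkew, rfl⟩

/-! ## §5 At a FAR depth, «hyperbolic cell alive» ⟺ «`k` is a hermitian norm» -/

/-- **ALIVE ⟺ `k ∈ N_{M∕K♮}(𝒪_Mˣ)` at a far depth.**  Frame: `ρ` involutive, `Θ` involutive, commuting, both isometric, `ϖE` a `ρ`-fixed uniformiser with `ΘϖE ≠ ϖE`, `Θ`-fixed
non-zero elements of even valuation, the RamK norm suppliers `hNF` (`𝒪_Fˣ ⊆ N`, ★ `QuadraticDatumNormsOfDoublyFixedUnits`) and `hNd` (`U_{K♮}^{(d)} ⊆ N`, ★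
`WildQuadraticDatumNormSurjective`), `1 ≤ d`.  If `z = k·e·w` with `k` a `Θ`-fixed unit, `e` a `ρ`-fixed unit, `|w − 1| ≤ exp(−c)` and `2d ≤ c + 1` (a FAR cell), then
`(∃ x e′ w′, |x| = 1 ∧ ρe′ = e′ ∧ |e′| = 1 ∧ |w′ − 1| ≤ exp(−c) ∧ z = xΘx·e′·w′) ↔ ∃ x, x·Θx = k` — `→`: `k∕(xΘx)` is a `Θ`-fixed unit of `𝒪_Eˣ·U^{(c)}`, hence (★ (M-RK1)
`exists_fixed_fixed_mul_of_eq_fixed_mul` + parity upgrade) in `𝒪_Fˣ·U_{K♮}^{(⌈c∕2⌉)} ⊆ N·N`. [cite: Serre1979, Ch. V §2 Prop. 3, §3 Cor. 3; Ch. IV §1] [cite: Flicker1998UnitaryFL, p. 84] -/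
theorem diag_alive_iff_exists_mul_theta_eq {ρ Θ : K →+* K} (hΘΘ : ∀ x, Θ (Θ x) = x) (hρΘ : ∀ x, ρ (Θ x) = Θ (ρ x))
    (hΘv : ∀ x, Valued.v (Θ x) = Valued.v x)
    {ϖE : K} (hϖE : Valued.v ϖE = exp (-1 : ℤ)) (hρϖ : ρ ϖE = ϖE) (hΘϖ : Θ ϖE ≠ ϖE)
    (hΘev : ∀ x : K, Θ x = x → x ≠ 0 → ∃ n : ℤ, Valued.v x = exp (2 * n))
    {d : ℕ} (hd : 1 ≤ d)
    (hNF : ∀ f : K, ρ f = f → Θ f = f → Valued.v f = 1 → ∃ x : K, x * Θ x = f)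
    (hNd : ∀ u : K, Θ u = u → Valued.v (u - 1) ≤ Valued.v ϖE ^ (2 * d) → ∃ x : K, x * Θ x = u)
    {z k e w : K} (hΘk : Θ k = k) (hvk : Valued.v k = 1) (hρe : ρ e = e) (hve : Valued.v e = 1) {c : ℕ} (hwc : Valued.v (w - 1) ≤ exp (-(c : ℤ)))
    (hz : z = k * e * w) (hdc : 2 * d ≤ c + 1) :
    (∃ x e' w' : K, Valued.v x = 1 ∧ ρ e' = e' ∧ Valued.v e' = 1 ∧ Valued.v (w' - 1) ≤ exp (-(c : ℤ)) ∧ z = x * Θ x * e' * w') ↔ ∃ x : K, x * Θ x = k := by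
  have hπ : ∀ n : ℕ, Valued.v ϖE ^ n = exp (-(n : ℤ)) := v_varpi_pow hϖE
  have hfix : ∀ a : K, Θ a = a → a ≠ 0 → Even (log (Valued.v a)) := even_log_v_of_fixed hΘev
  have hΘρ : ∀ x, Θ (ρ x) = ρ (Θ x) := fun x => (hρΘ x).symm
  -- `|x·Θx| = 1 ⇒ |x| = 1`
  have hunit : ∀ x f : K, x * Θ x = f → Valued.v f = 1 → Valued.v x = 1 := by
    intro x f hxf hf
    have h : Valued.v x * Valued.v x = 1 := by rw [← hf, ← hxf, Valuation.map_mul, hΘv]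
    rcases lt_trichotomy (Valued.v x) 1 with h1 | h1 | h1
    · exfalso
      have hlt : Valued.v x * Valued.v x < 1 :=
        calc Valued.v x * Valued.v x ≤ Valued.v x * 1 := by gcongr
          _ < 1 := by rw [mul_one]; exact h1
      rw [h] at hlt; exact lt_irrefl _ hlt
    · exact h1
    · exfalso
      have hlt : 1 < Valued.v x * Valued.v x :=
        calc (1 : ℤᵐ⁰) < Valued.v x := h1
          _ = Valued.v x * 1 := (mul_one _).symm
          _ ≤ Valued.v x * Valued.v x := by gcongr
      rw [h] at hlt; exact lt_irrefl _ hlt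
  -- `|w| = 1`
  have hc1 : 1 ≤ c := by omega
  have hunit1 : ∀ w₀ : K, Valued.v (w₀ - 1) ≤ exp (-(c : ℤ)) → Valued.v w₀ = 1 := by
    intro w₀ hw₀
    have hlt : Valued.v (w₀ - 1) < Valued.v (1 : K) := by
      rw [Valuation.map_one]; exact lt_of_le_of_lt hw₀ (by rw [← exp_zero, exp_lt_exp]; omega)
    have h := Valuation.map_add_eq_of_lt_left _ hlt
    rwa [add_sub_cancel, Valuation.map_one] at h
  have hvw : Valued.v w = 1 := hunit1 w hwc
  constructor
  · rintro ⟨x, e', w', hvx, hρe', hve', hw', hz'⟩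
    have hvw' : Valued.v w' = 1 := hunit1 w' hw'
    have hx0 : x ≠ 0 := fun h => by rw [h, map_zero] at hvx; exact zero_ne_one hvx
    have hΘx0 : Θ x ≠ 0 := (map_ne_zero Θ).2 hx0
    have he0 : e ≠ 0 := fun h => by rw [h, map_zero] at hve; exact zero_ne_one hve
    have hw0 : w ≠ 0 := fun h => by rw [h, map_zero] at hvw; exact zero_ne_one hvw
    -- `u₀ := k ∕ (xΘx)` is a `Θ`-fixed unit of `𝒪_Eˣ·U^{(c)}`
    set u₀ := k / (x * Θ x) with hu₀
    have hΘu₀ : Θ u₀ = u₀ := by rw [hu₀, map_div₀, map_mul, hΘΘ, hΘk, mul_comm (Θ x) x]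
    have hu₀eq : u₀ = (e' / e) * (w' / w) := by
      rw [hu₀, div_eq_iff (mul_ne_zero hx0 hΘx0)]
      have h : k * e * w = x * Θ x * e' * w' := by rw [← hz, hz']
      field_simp
      linear_combination h
    have hρee : ρ (e' / e) = e' / e := by rw [map_div₀, hρe', hρe]
    have hvee : Valued.v (e' / e) = 1 := by rw [map_div₀, hve', hve, div_one]
    have hww : Valued.v (w' / w - 1) ≤ exp (-(c : ℤ)) := by
      have h : w' / w - 1 = ((w' - 1) - (w - 1)) / w := by field_simp; ring
      rw [h, map_div₀, hvw, div_one]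
      exact (Valuation.map_sub _ _ _).trans (max_le hw' hwc)
    obtain ⟨f, w'', hρf, hΘf, hvf, hΘw'', hw'', hu₀fw⟩ :=
      exists_fixed_fixed_mul_of_eq_fixed_mul hΘΘ hΘρ hΘv hfix hρϖ hϖE hΘϖ hΘu₀ hρee hvee hww hu₀eq
    have hw''d : Valued.v (w'' - 1) ≤ Valued.v ϖE ^ (2 * d) := by
      refine (v_sub_one_le_of_theta_fixed hfix hΘw'' hw'').trans ?_
      rw [hπ, exp_le_exp]; omega
    obtain ⟨x₁, hx₁⟩ := hNF f hρf hΘf hvf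
    obtain ⟨x₂, hx₂⟩ := hNd w'' hΘw'' hw''d
    refine ⟨x * x₁ * x₂, ?_⟩
    have hk : k = x * Θ x * u₀ := by rw [hu₀, mul_div_cancel₀ _ (mul_ne_zero hx0 hΘx0)]
    rw [hk, hu₀fw, ← hx₁, ← hx₂, map_mul, map_mul]; ring
  · rintro ⟨x, hx⟩
    exact ⟨x, e, w, hunit x k hx hvk, hρe, hve, hwc, by rw [hz, hx]⟩

end Summit.HodgeConjecture.HodgeConjecture.Cruxes.H413.F0P3cDyRamTokenSignRamK
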